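import Summits.AnomalousDissipation.AnomalousDissipation.Theses.RootDecompCycle1C

/-!
# Glue of the OR-branch `JunctionCascadeAnomaly → FrozenLift → SteadyDesignerAnomaly` of route 1C

Sorry-free proof of the GLUE item `RootDecompCycle1C.SteadyDesignerAnomalyGlue` (stmt-AnomalousDissipation-27507):
the junction-cascade leaf (frozen planar designer carriers `v j` with a steady passive scalar `w j` carrying a ν-uniform
scalar-dissipation floor) is an instance of the frozen-carrier scalar anomaly that `FrozenLift` lifts to a steady designer
family on `T³` (take `θ₀ j := w j`, `θ j t := w j`); then modus ponens.  No facts are asserted.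
Source: decomp-ad cell, lens-6 g4/g5 node «JunctionCascade» (kernel `run/shared/lean/pub/decomp-ad/decomp-ad-lens-6/JunctionCascade_r1.lean`,
theorems `frozen_of_junction` / `steadyDesigner_of_junction`); landed by the cell's prover seat.
-/

set_option linter.dupNamespace false

open Filter Topology

namespace Summit.AnomalousDissipation.AnomalousDissipation.Theorems.SteadyDesignerAnomalyGlue

open Summit.AnomalousDissipation.AnomalousDissipation.Theses.RootDecompCycle1C

/-- The GLUE item `RootDecompCycle1C.SteadyDesignerAnomalyGlue` (stmt-AnomalousDissipation-27507) holds: the junction-cascade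
family is a frozen-carrier scalar-anomaly family with the steady scalar `θ j t := w j`, and `FrozenLift` applies. [folklore] -/
theorem steadyDesignerAnomalyGlue_holds : SteadyDesignerAnomalyGlue := by
  intro hJ hL
  obtain ⟨F, h, hF, hh, hh0, ν, Fs, v, _vInf, w, hν, hν0, hFs, hFsF, hv, hLH, hE, _, _, _, _, hw2, hweak, hEw, ε,
    hε, hfloor⟩ := hJ
  exact hL ⟨F, h, hF, hh, hh0, ν, Fs, v, w, fun j _ => w j, hν, hν0, hFs, hFsF, hv, hLH, hE, hw2, hweak, hEw, ε, hε,
    hfloor⟩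

end Summit.AnomalousDissipation.AnomalousDissipation.Theorems.SteadyDesignerAnomalyGlue
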